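import Summits.Langlands.Langlands.Statement
import Literature.NumberTheory.Automorphic.GelbartJacquetSymmSquare
import Literature.NumberTheory.Automorphic.Sweep1SymmetricPower
import HarnessLib

/-!
# Line `SymmFifthGaloisToAutomorphic` — F3 SPECIAL-CASE FILE (forward generator G4 ladder-down, generation 7)
# top crux `IrreducibilityBySelfDuality.ReciprocityUpToIrreducibility` (stmt-Langlands-14328)

Dial θ15 = the SYMMETRIC-POWER DEGREE `m` of clause (B) of E over EVERY number field `F`.
Contents (no `sorry`): §1 the a.e. symmetric-power-lift predicate `IsSymmPowerLiftAE` and the text family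
`WeakSymmPowerFunctoriality m` with the two print floors as texts (`KimShahidi2002_symmCube_automorphic`
[cite: KimShahidi2002, Thm. B], `Kim2003_symmFourth_automorphic` [cite: Kim2003, Thm. B]); §2 the graded family
`SymmPowerGaloisToAutomorphic m` and THE RUNG `SymmFifthGaloisToAutomorphic := SymmPowerGaloisToAutomorphic 5`;
§3 `of_weakSymmPowerFunctoriality : WeakSymmPowerFunctoriality m → SymmPowerGaloisToAutomorphic m`;
§4 the floors `floor_one` (tautological), `floor_two (hGJ : GelbartJacquet_symmSq_automorphic)` (the WITNESS: the
in-tree named fact Gelbart–Jacquet 1978 Thm (9.3), bridged by `symmPowerParams_two : symmPowerParams 2 a b =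
symmSqParams {a, b}`), `floor_three_of`, `floor_four_of`; and the F3 instance
`example (hGJ) : SymmPowerGaloisToAutomorphic 2 := by simpa using floor_two hGJ`.
-/

noncomputable section

set_option linter.dupNamespace false

open scoped MatrixGroups Matrix NumberField Classical Polynomial
open Filter IsDedekindDomain Field Polynomial
open Literature.NumberTheory.Automorphic Literature.NumberTheory.GaloisRepresentations
open Literature.NumberTheory.PAdicHodge
open Summit.Langlands

namespace Summit.Langlands.Langlands.Cruxes.ReciprocityUpToIrreducibility.SymmFifthGaloisToAutomorphic

/-! ## 1. Weak symmetric-power lifts in the Borel–Jacquet datum model -/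

/-- **`P` is an almost-everywhere `m`-th symmetric power lift of `π`** (`t_{P,v} = Symᵐ t_{π,v}` for almost
all `v`): for all but finitely many finite places `v`, whenever `π` on `GL₂(𝔸_F)` has Satake pair `{a, b}` at
`v`, `P` on `GL_{m+1}(𝔸_F)` has Satake parameter `Symᵐ{a, b} = {aⁱ b^{m-i} : 0 ≤ i ≤ m}` (`symmPowerParams`)
at `v`.  Same design as `IsSymmSqLiftAE` (Gelbart–Jacquet file) and `IsWeakSymmPowerLift` (Newton–Thorne file,
`L²`-model). [cite: NewtonThorneIHES2021b, §1 (p. 117)] -/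
def IsSymmPowerLiftAE (m : ℕ) {F : Type} [Field F] [NumberField F]
    {h2 : isCompact_glFiniteIntegralLevel 2 F} {hm : isCompact_glFiniteIntegralLevel (m + 1) F}
    (π : AutomorphicRepData (AutomorphyDatum.gl 2 F h2))
    (P : AutomorphicRepData (AutomorphyDatum.gl (m + 1) F hm)) : Prop :=
  ∀ᶠ v : HeightOneSpectrum (𝓞 F) in cofinite, ∀ a b : ℂ,
    π.HasSatakeParamAt v {a, b} → P.HasSatakeParamAt v (symmPowerParams m a b)

/-- **Weak `Symᵐ` functoriality `GL₂ → GL_{m+1}` over every number field** (the text family of which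
Gelbart–Jacquet 1978 is `m = 2`, Kim–Shahidi 2002 Thm B is `m = 3`, Kim 2003 Thm B is `m = 4`, and `m ≥ 5` is
OPEN in this generality): every cuspidal `π` on `GL₂(𝔸_F)` has an a.e. `Symᵐ`-lift which is an automorphic
representation of `GL_{m+1}(𝔸_F)` (Borel–Jacquet datum, not asserted cuspidal). -/
def WeakSymmPowerFunctoriality (m : ℕ) : Prop :=
  ∀ (F : Type) [Field F] [NumberField F] (h2 : isCompact_glFiniteIntegralLevel 2 F)
    (hm : isCompact_glFiniteIntegralLevel (m + 1) F) (π : CuspidalAutomorphicRepData 2 F h2),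
    ∃ P : AutomorphicRepData (AutomorphyDatum.gl (m + 1) F hm), IsSymmPowerLiftAE m π.1 P

/-- **Kim–Shahidi 2002, Theorem B (symmetric cube).**  H. H. Kim, F. Shahidi, *Functorial products for
`GL₂ × GL₃` and the symmetric cube for `GL₂`*, Ann. of Math. 155 (2002), 837–893, Thm. B: "Let `π` be a
cuspidal automorphic representation of `GL₂(𝔸_F)` [`F` any number field]. Then `Sym³(π)` is an automorphic
representation of `GL₄(𝔸_F)`. It is cuspidal unless `π` is of dihedral or tetrahedral type"; `Sym³(π) = ⊗_v
Sym³(π_v)` with `Sym³(π_v)` attached to `Sym³ ∘ φ_v` by the local Langlands correspondence, so at an unramified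
`v` with `t_{π,v} = {a, b}`, `t_{Sym³π,v} = {a³, a²b, ab², b³}`.  Vendored at the level of Satake parameters
at almost all places (the only local vocabulary of the datum model), as `WeakSymmPowerFunctoriality 3`; the
cuspidality criterion is not part of this text. Named-fact TEXT (D-0014; proposed into
`Literature/NumberTheory/Automorphic/`). [cite: KimShahidi2002, Thm. B] -/
def KimShahidi2002_symmCube_automorphic : Prop := WeakSymmPowerFunctoriality 3

/-- **Kim 2003, Theorem B (symmetric fourth).**  H. H. Kim, *Functoriality for the exterior square of `GL₄`
and the symmetric fourth of `GL₂`*, J. Amer. Math. Soc. 16 (2003), 139–183, Thm. B: "Let `π` be a cuspidal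
representation of `GL₂(𝔸_F)` [`F` any number field]. Then `Sym⁴(π)` is an automorphic representation of
`GL₅(𝔸_F)`. If `Sym³(π)` is cuspidal, `Sym⁴(π)` is either cuspidal or …" (proof: `∧²(Sym³π) = Sym⁴π ⊗ ω_π ⊞
ω_π³` and Theorem A, `∧² : GL₄ → GL₆`), with `t_{Sym⁴π,v} = {a⁴, a³b, a²b², ab³, b⁴}` at the unramified places.
Vendored as `WeakSymmPowerFunctoriality 4`, Satake level, a.e.; cuspidality criterion (Kim–Shahidi, Duke 112
(2002)) not included. Named-fact TEXT (D-0014; proposed into `Literature/NumberTheory/Automorphic/`).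
[cite: Kim2003, Thm. B] -/
def Kim2003_symmFourth_automorphic : Prop := WeakSymmPowerFunctoriality 4

/-! ## 2. The graded family (dial = symmetric-power degree `m`, rank `m + 1`) and the rung `m = 5` -/

/-- **The rung family** `SymmPowerGaloisToAutomorphic m`: clause (B) of the summit (Galois ⇒ automorphic) over
EVERY number field `F`, at EVERY `ℓ` and `ι : ℚ̄_ℓ ≃ ℂ`, in the a.e.-Satake form, for irreducible
`ρ : Γ_F → GL_{m+1}(ℚ̄_ℓ)` de Rham above `ℓ` (pinned Fontaine datum `fontainePstAdicCompletion`) whose Frobenius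
characteristic polynomials are, at all but finitely many places, the `ι`-Satake polynomials of `Symᵐ{a_v, b_v}`
for the Satake pairs `{a_v, b_v}` of a CUSPIDAL `π` on `GL₂(𝔸_F)` — the unramified shadow of "`ρ ≅ Symᵐ ρ_π`".
Conclusion: an AUTOMORPHIC `P` on `GL_{m+1}(𝔸_F)` (Borel–Jacquet datum, not asserted cuspidal) with
`SatakeFrobCompatibleAt ι P ρ v` for almost all `v`.  Monotone in the summit direction
(`symmPowerGaloisToAutomorphic_of_langlands`); implied by weak `Symᵐ` functoriality
(`of_weakSymmPowerFunctoriality`), hence PROVED at `m = 2` (Gelbart–Jacquet, in tree) and known in print at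
`m = 3, 4` (Kim–Shahidi, Kim); OPEN at `m = 5` off the totally-real regular-algebraic sector (Newton–Thorne). -/
def SymmPowerGaloisToAutomorphic (m : ℕ) : Prop :=
  ∀ (F : Type) [Field F] [NumberField F]
    (h2 : Literature.NumberTheory.Automorphic.isCompact_glFiniteIntegralLevel 2 F)
    (π : Literature.NumberTheory.Automorphic.CuspidalAutomorphicRepData 2 F h2)
    (ℓ : ℕ) [Fact ℓ.Prime] (ι : PadicAlgCl ℓ ≃+* ℂ)
    (ρ : Literature.NumberTheory.GaloisRepresentations.FramedGaloisRep F (PadicAlgCl ℓ) (m + 1)),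
    ρ.toGaloisRep.IsIrreducible →
    (∀ (v : IsDedekindDomain.HeightOneSpectrum (NumberField.RingOfIntegers F))
      (hv : ((ℓ : ℕ) : NumberField.RingOfIntegers F) ∈ v.asIdeal),
      (Literature.NumberTheory.PAdicHodge.fontainePstAdicCompletion v ℓ hv).IsDeRhamFramed (ρ.toLocal v)) →
    (∀ᶠ v : IsDedekindDomain.HeightOneSpectrum (NumberField.RingOfIntegers F) in Filter.cofinite,
      ∃ a b : ℂ, π.1.HasSatakeParamAt v {a, b} ∧ ρ.IsUnramifiedAt v ∧
        ρ.HasFrobCharpolyAt v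
          (Literature.NumberTheory.Automorphic.arithFrobPolyOfSatake ι v.residueCard 1
            (Literature.NumberTheory.Automorphic.symmPowerParams m a b))) →
    ∀ hcpt : Literature.NumberTheory.Automorphic.isCompact_glFiniteIntegralLevel (m + 1) F,
      ∃ P : Literature.NumberTheory.Automorphic.AutomorphicRepData
          (Literature.NumberTheory.Automorphic.AutomorphyDatum.gl (m + 1) F hcpt),
        ∀ᶠ v : IsDedekindDomain.HeightOneSpectrum (NumberField.RingOfIntegers F) in Filter.cofinite,
          Summit.Langlands.SatakeFrobCompatibleAt ι P ρ v

/-- **THE RUNG** (the filed statement): the family at `m = 5` — clause (B) for `GL₆`-representations of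
symmetric-fifth type over every number field. -/
def SymmFifthGaloisToAutomorphic : Prop := SymmPowerGaloisToAutomorphic 5

/-! ## 3. Weak functoriality at `m` gives the rung family at `m` -/

/-- **`WeakSymmPowerFunctoriality m → SymmPowerGaloisToAutomorphic m`**: the automorphic a.e. `Symᵐ`-lift `P`
of `π` has, at almost every `v`, the Satake parameter `Symᵐ{a_v, b_v}`, which is what the sector clause says
`ρ(Frob_v)` has as inverse-root data.  (The converse is not claimed: the family only asks for automorphy
when an irreducible de Rham `ρ` of symmetric-power type exists.) [folklore] -/
theorem of_weakSymmPowerFunctoriality {m : ℕ} (h : WeakSymmPowerFunctoriality m) :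
    SymmPowerGaloisToAutomorphic m := by
  intro F _ _ h2 π ℓ _ ι ρ _hirr _hdR hsym hcpt
  obtain ⟨P, hP⟩ := h F h2 hcpt π
  refine ⟨P, ?_⟩
  have hP' : ∀ᶠ v : HeightOneSpectrum (𝓞 F) in cofinite, ∀ a b : ℂ,
      π.1.HasSatakeParamAt v {a, b} → P.HasSatakeParamAt v (symmPowerParams m a b) := hP
  filter_upwards [hsym, hP'] with v hv hPv
  obtain ⟨a, b, hπ, hur, hcp⟩ := hv
  exact ⟨symmPowerParams m a b, hPv a b hπ, hur, hcp⟩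

/-! ## 4. The floors: `m = 1` (tautological), `m = 2` (Gelbart–Jacquet, IN TREE), `m = 3, 4` (texts) -/

/-- `Sym²{a, b} = {a², ab, b²}`: the Newton–Thorne-file multiset `symmPowerParams 2 a b` is the
Gelbart–Jacquet-file multiset `symmSqParams {a, b}`. [folklore] -/
theorem symmPowerParams_two (a b : ℂ) : symmPowerParams 2 a b = symmSqParams {a, b} := by
  rw [symmSqParams_pair, symmPowerParams_def]
  simp [Multiset.range_succ, pow_two]

/-- **Gelbart–Jacquet gives weak `Sym²` functoriality in the `symmPowerParams` rendering.**
[cite: GelbartJacquet1978, (3.6)–(3.7), Thm. (9.3) (3)] -/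
theorem weakSymmPowerFunctoriality_two (hGJ : GelbartJacquet_symmSq_automorphic) :
    WeakSymmPowerFunctoriality 2 := by
  intro F _ _ h2 h3 π
  obtain ⟨P, hP⟩ := hGJ F h2 h3 π
  refine ⟨P, ?_⟩
  have hP' := (isSymmSqLiftAE_iff π.1 P).mp hP
  show ∀ᶠ v : HeightOneSpectrum (𝓞 F) in cofinite, ∀ a b : ℂ,
      π.1.HasSatakeParamAt v {a, b} → P.HasSatakeParamAt v (symmPowerParams 2 a b)
  filter_upwards [hP'] with v hv a b hab
  rw [symmPowerParams_two]
  exact hv {a, b} hab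

/-- **THE FLOOR of the ladder (`m = 2`, PROVED modulo the in-tree named fact)**: clause (B) for irreducible
de Rham `ρ : Γ_F → GL₃(ℚ̄_ℓ)` of symmetric-square type, over every number field — Gelbart–Jacquet 1978.
[cite: GelbartJacquet1978, Thm. (9.3)] [cite: Gelbart1997, Thm. 5.3.2 (i)] -/
theorem floor_two (hGJ : GelbartJacquet_symmSq_automorphic) : SymmPowerGaloisToAutomorphic 2 :=
  of_weakSymmPowerFunctoriality (weakSymmPowerFunctoriality_two hGJ)

/-- Print floor `m = 3` from the Kim–Shahidi text. [cite: KimShahidi2002, Thm. B] -/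
theorem floor_three_of (h : KimShahidi2002_symmCube_automorphic) : SymmPowerGaloisToAutomorphic 3 :=
  of_weakSymmPowerFunctoriality h

/-- Print floor `m = 4` (the highest PROVED rung in print, all `F`, all cuspidal `π`) from the Kim text.
[cite: Kim2003, Thm. B] -/
theorem floor_four_of (h : Kim2003_symmFourth_automorphic) : SymmPowerGaloisToAutomorphic 4 :=
  of_weakSymmPowerFunctoriality h

/-- `m = 1` is tautological (`Sym¹ π = π`: take `P := π`); recorded only to show the family is graded from
the bottom. [folklore] -/
theorem floor_one : SymmPowerGaloisToAutomorphic 1 := by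
  refine of_weakSymmPowerFunctoriality ?_
  intro F _ _ h2 h2' π
  refine ⟨π.1, ?_⟩
  show ∀ᶠ v : HeightOneSpectrum (𝓞 F) in cofinite, ∀ a b : ℂ,
      π.1.HasSatakeParamAt v {a, b} → π.1.HasSatakeParamAt v (symmPowerParams 1 a b)
  filter_upwards with v a b hab
  rwa [symmPowerParams_one]

/-- **F3 special-case instance**: the family at the floor parameter `m = 2` IS the floor (modulo the floor's
in-tree named fact, exactly as the tree holds it). -/
example (hGJ : GelbartJacquet_symmSq_automorphic) : SymmPowerGaloisToAutomorphic 2 := by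
  simpa using floor_two hGJ

end Summit.Langlands.Langlands.Cruxes.ReciprocityUpToIrreducibility.SymmFifthGaloisToAutomorphic

end
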